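import Summits.AnomalousDissipation.AnomalousDissipation.Theorems.SolenoidalFractalHomogenisationLagrangianStepCellCorrectorContent
import HarnessLib

/-!
# K1L `LagrangianRenormalisationStep(Design)` (stmt-AnomalousDissipation-24912 → K1L_D), stub `stub_cellEnergyT` (clause (F) uniform in `T`,
# finding F-p4g10-1): MEAN CONSERVATION of weak tensor passive-vector solutions — the S-item `MeanConservation` of p4 g10's typed split
# (helper; `--supports … --as helper`)

Summits-side helper file of route `SolenoidalFractalHomogenisation` (everything proved; no definitions, no named facts, no sorry).  The typed split
`UniformSlowLeak ⇐ SlowModeBound + SectorCount + MeanConservation` of `Cruxes/LagrangianRenormalisationStep/DualLeakageSketch.lean` §4 (planner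
ad-ideate-p4 g10, sha16 4d91f26f3bd1b383; cell STATUS 2026-08-28T13:43:50Z «any idle prover: S-items …») asks for

  `MeanConservation :⇔ ∀ T 𝔹 b, stLift b ∈ L^∞((0,T) × ℝ³) → ∀ w₀ w, w₀ ∈ L² → IsWeakTensorPassiveVectorOn 0 T 𝔹 b w₀ w →
     ∀ᵐ t ∈ (0,T), ∀ i, modeCoeff 0 (w t) i = modeCoeff 0 w₀ i`.

`ae_modeCoeff_zero_eq` below has EXACTLY that body (so `meanConservation : MeanConservation := ae_modeCoeff_zero_eq` wherever the Prop is landed).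
Proof: the modewise integral identity of the cell's literature lane (`IsWeakTensorPassiveVectorOn.ae_inner_mFourierCoeff_eq`, tested with the
constant divergence-free fields `θ(t)·e_i`, every `z ∈ ℂ³` being transversal at `k = 0`) has vanishing right-hand side at the zero frequency
(`symbT 𝔹 0 = 0`, and the transport sums carry the factor `2πi·k_j = 0`), so `⟪ŵ(t)(0), e_i⟫ = ⟪ŵ₀(0), e_i⟫` for a.e. `t`; the dictionary
`modeCoeff_eq` (p634914) translates to `modeCoeff`.  (The `L^∞` hypothesis on the carrier is part of the Prop's text and unused.)
Infrastructure for route-1's rung leaf F-D1.A0 (a frontier FORMAL rung); NOT a proof of the stub, of the crux, of Onsager's conjecture or of anomalous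
dissipation.  Prover seat `ad-k3l-bookkeeping-p1` g3 (idle-prover S-item), 2026-08-28.
-/

set_option linter.dupNamespace false

noncomputable section

namespace Summit.AnomalousDissipation.AnomalousDissipation.Theorems.SolenoidalFractalHomogenisation.LagrangianStep

open Literature.Analysis Literature.Analysis.FluidPDE Literature.Analysis.FunctionSpaces
open MeasureTheory Set Filter Function UnitAddTorus
open scoped ENNReal NNReal InnerProductSpace

/-- **Mean conservation for weak tensor passive-vector solutions** (the text of p4 g10's `MeanConservation`): the mode `0` of a weak solution of
`∂ₜw + (b·∇)w + ∇π = 𝓛_𝔹 w`, `∇·w = 0` along an `L^∞` carrier from an `L²` datum is that of the datum for a.e. `t ∈ (0,T)` — the weak formulation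
tested with the constant fields `θ(t)·eᵢ` (`convect b (const) = 0`, `viscAdj 𝔹 (const) = 0`). [cite: Temam1984, Ch. III §1.1 (weak formulation tested modewise)] -/
theorem ae_modeCoeff_zero_eq :
    ∀ (T : ℝ) (𝔹 : Torus.Visc4 (Fin 3)) (b : ℝ → VF),
      MemLp (FunctionSpaces.Torus.stLift b) ∞ (volume.restrict (Ioo 0 T ×ˢ (univ : Set (EuclideanSpace ℝ (Fin 3))))) →
    ∀ (w₀ : VF) (w : ℝ → VF), MemLp w₀ 2 volume → Torus.IsWeakTensorPassiveVectorOn 0 T 𝔹 b w₀ w →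
      ∀ᵐ t ∂(volume.restrict (Ioo 0 T)), ∀ i, modeCoeff 0 (w t) i = modeCoeff 0 w₀ i := by
  intro T 𝔹 b _hb w₀ w hw₀ h
  have hw₀i : Integrable w₀ volume := hw₀.integrable one_le_two
  -- every `z` is transversal at the zero frequency
  have hz : ∀ i : Fin 3, ∑ j, (((0 : Fin 3 → ℤ) j : ℤ) : ℂ) * (EuclideanSpace.single i (1:ℂ)) j = 0 := fun i => by
    simp only [Pi.zero_apply, Int.cast_zero, zero_mul, Finset.sum_const_zero]
  have hmode : ∀ i : Fin 3, ∀ᵐ t ∂(volume.restrict (Ioo 0 T)),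
      ⟪mFourierCoeff (FunctionSpaces.EuclideanSpace.complexify ∘ w t) 0, EuclideanSpace.single i (1:ℂ)⟫_ℂ =
        ⟪mFourierCoeff (FunctionSpaces.EuclideanSpace.complexify ∘ w₀) 0, EuclideanSpace.single i (1:ℂ)⟫_ℂ := by
    intro i
    filter_upwards [h.ae_inner_mFourierCoeff_eq hw₀i 0 (hz i)] with t ht
    rw [ht]
    simp only [Torus.symbT_zero_freq, inner_zero_right, mul_zero, Pi.zero_apply, Int.cast_zero, zero_mul,
      Finset.sum_const_zero, add_zero, integral_zero]
  have hall : ∀ᵐ t ∂(volume.restrict (Ioo 0 T)), ∀ i : Fin 3,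
      ⟪mFourierCoeff (FunctionSpaces.EuclideanSpace.complexify ∘ w t) 0, EuclideanSpace.single i (1:ℂ)⟫_ℂ =
        ⟪mFourierCoeff (FunctionSpaces.EuclideanSpace.complexify ∘ w₀) 0, EuclideanSpace.single i (1:ℂ)⟫_ℂ :=
    ae_all_iff.2 hmode
  filter_upwards [hall, h.ae_integrable_slice] with t ht hint i
  have hi := ht i
  rw [EuclideanSpace.inner_single_right, EuclideanSpace.inner_single_right, one_mul, one_mul] at hi
  have hi' := congrArg (starRingEnd ℂ) hi
  simp only [RingHomCompTriple.comp_apply, RingHom.id_apply] at hi'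
  rw [modeCoeff_eq hint.1, modeCoeff_eq hw₀i]
  exact hi'

end Summit.AnomalousDissipation.AnomalousDissipation.Theorems.SolenoidalFractalHomogenisation.LagrangianStep

end
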